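import Summits.ABC.ABC.Theorems.RibetTakahashiSplitManyPrimeValuationProductBootstrap

/-!
# `ManyPrimeValuationProduct` conditionally on the route item `WeightedSzpiroBound` (proof-of-item, CONDITIONAL)

Crux stmt-ABC-1561 `Summit.ABC.ABC.Theses.RibetTakahashiSplit.ManyPrimeValuationProduct` (r2 of
route-ABC-RibetTakahashiSplit) is Pasten's folklore Conjecture 1.14 in geometric form (arXiv:1705.09251 p. 8, "not a
mild conjecture"); it is OPEN and this file does NOT prove it.  What it records, as the item's deciding-theorem shape
with ONE hypothesis that is itself a route item, is the in-route derivation edge r3′ ⟹ r2: the rank-3 item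
`WeightedSzpiroBound` (stmt-ABC-3272) alone implies r2 (bootstrap r3′ ⟹ `|Δ_min| ≤ C N^{14}` on the curves semistable
away from `2` ⟹ `T(E) ≤ C_ε N^ε`, `Summit.ABC.ABC.Theorems.weightedSzpiroBound_bootstrap`, landed p81483 as a
`--supports` helper).  Consequently r2 is a REDUNDANT hypothesis of the route's deciding theorem
`closes : ManyPrimeValuationProduct → WeightedSzpiroBound → FewPrimeValuationProduct → Assembly → ABC`
(`closes (manyPrimeValuationProduct_of_weightedSzpiroBound h₃) h₃ h₄ hA` elaborates), which is why the gate's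
auto-crux backfill ("hypotheses of the deciding theorem that nothing in the route derives") keeps re-badging this
conjecture-grade item as a crux; this conditional result puts the derivation on the item's ledger record.
-/

-- `Summit.ABC.ABC` is the mandated summit-side namespace (CONVENTIONS §2); the duplicate is deliberate.
set_option linter.dupNamespace false

namespace Summit.ABC.ABC.Theorems

/-- **r2 conditionally on r3′** (CONDITIONAL proof-of-item for stmt-ABC-1561; the hypothesis is the route item
`WeightedSzpiroBound`, stmt-ABC-3272, itself open and `ABC`-equivalent in the tree): the bootstrap
`manyPrimeValuationProduct_of_weightedSzpiroBound` (p81483). [folklore] -/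
theorem ManyPrimeValuationProduct_conditional_proof
    (h₃ : Summit.ABC.ABC.Theses.RibetTakahashiSplit.WeightedSzpiroBound) :
    Summit.ABC.ABC.Theses.RibetTakahashiSplit.ManyPrimeValuationProduct :=
  manyPrimeValuationProduct_of_weightedSzpiroBound h₃

end Summit.ABC.ABC.Theorems
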